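import Literature.AlgebraicGeometry.HodgeTheory.HodgeConjectureCompleteIntersectionsVerySmallDegreeOfELV
import Literature.AlgebraicGeometry.HodgeTheory.GeneralHodgePropertyOfSmallChowGroup
import Literature.AlgebraicGeometry.HodgeTheory.GeneralHodgePropertyOffDiagonalWindow
import Literature.AlgebraicGeometry.HodgeTheory.MaxRationalSubHodgeStructureHardLefschetz
import Literature.AlgebraicGeometry.HodgeTheory.FivefoldChowZeroDegenerateHodgeConjecture
import Literature.AlgebraicGeometry.Motives.FanoRationallyChainConnected
import HarnessLib

/-!
# Grothendieck's amended GENERAL Hodge conjecture in ALL bidegrees from small Chow groups: `CH₀, …, CH_{k₀}` of rank `≤ 1` gives `GHC(X, k, r)` for every `k` and every `r ≤ k₀ + 1`, hence ALL of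
# `GHC(X)` when `dim X ≤ 2k₀ + 4`, and all but the middle cell `(dim X, k₀ + 2)` when `dim X = 2k₀ + 5` — fourfolds with `CH₀` on a surface, five/sixfolds with `CH₀ = CH₁ = ℚ`, cubic hypersurfaces of
# dimension `≤ 6` and `8` granted ELV (+ Hirschowitz–Iyer) (Grothendieck 1969; Laterveer 1998; Voisin II Thm. 10.29/10.31; Vial 2013 Thm. 7.1; Bloch–Srinivas 1983; Voisin 2025 Cor. 5.7)

Family `hodge`, lane `lit-hodgefound` (Track 2 foundations library; Layers A1/A4), layer `Literature/AlgebraicGeometry/HodgeTheory`.  THEOREMS ONLY (no definition, no NEW named fact, no instance;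
D-0026 net debt `0`).  Sequel of the seat's g33-#7/#8 (`BettiHodgeConjectureProductsSmallChowGroups`: `hodgeConjectureFor_of_chowRankLEOneUpTo`; `HodgeConjectureCompleteIntersectionsVerySmallDegreeOfELV`:
ELV ⟹ `ChowRankLEOneUpTo`) and of the tree's `GeneralHodgePropertyOfSmallChowGroup` (`GHC(X, k, 1)` from `CH₀`; threefolds; fourfolds «iff `GHC(X, 4, 2)`»), `GeneralHodgePropertyOffDiagonalWindow`
(fivefolds iff four cells) and `MaxRationalSubHodgeStructureHardLefschetz` (`forall_generalHodgePropertyFor_iff_lower_window`).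

THE ARGUMENT.  (1) `Motives.ChowRankLEOneUpTo X k₀` gives `Nʳ Hᵏ(X) = Hᵏ(X)` for `1 ≤ r ≤ k₀ + 1`, `2r ≤ k + 1` (the tree's PROVED generalised decomposition of the diagonal
`supportedClasses_eq_top_of_chowRankLEOneUpTo` at level `r − 1 ≤ k₀`), so `GHC(X, k, r)` holds there («`Nʳ Hᵏ` is everything», `generalHodgePropertyFor_of_supportedClasses_eq_top`); for `2r > k + 1` the cell
is empty (`generalHodgePropertyFor_of_not_window`).  Hence `GHC(X, k, r)` for EVERY `k` and every `r ≤ k₀ + 1`.  (2) By hard Lefschetz `GHC(X)` reduces to the lower window `1 ≤ r`, `2r ≤ i ≤ dim X`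
(`forall_generalHodgePropertyFor_iff_lower_window`); a cell with `r ≥ k₀ + 2` there has `i ≥ 2k₀ + 4`, so for `dim X ≤ 2k₀ + 4` only `(2k₀ + 4, k₀ + 2)` can remain, which is `HC` in degree `2k₀ + 4` —
g33-#7's `hodgeConjectureFor_of_chowRankLEOneUpTo` (`dim X ≤ 2k₀ + 5`) and `generalHodgePropertyFor_two_mul_self_of_hodgeConjectureFor`.  For `dim X = 2k₀ + 5` the cells with `r = k₀ + 2` are
`(2k₀ + 4, k₀ + 2)` (`HC`, same) and the middle odd cell `(2k₀ + 5, k₀ + 2)` — the level-one part of the middle cohomology — which is therefore the ONLY open cell.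

WHAT IS PROVED (`0` sorrys; every statement a theorem).
* §1 `supportedClasses_eq_top_of_chowRankLEOneUpTo_of_le`, **`generalHodgePropertyFor_of_chowRankLEOneUpTo`** (`r ≤ k₀ + 1`, any `k`).
* §2 **`forall_generalHodgePropertyFor_of_chowRankLEOneUpTo`** (`dim X ≤ 2k₀ + 4` ⟹ `GHC(X, i, r)` for all `i, r`); §3 `forall_generalHodgePropertyFor_iff_middle_of_chowRankLEOneUpTo` (`dim X = 2k₀ + 5`:
  all of `GHC(X)` iff `GHC(X, dim X, k₀ + 2)`).
* §4 Unconditional instances: ALL of `GHC` for fourfolds with `CH₀ ⊗ ℚ` of rank `≤ 1` or with `CH₀` supported on a surface (closing the tree's «iff `GHC(X, 4, 2)`» by the tree's `HC` for such fourfolds),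
  for rationally chain connected fourfolds, Fano fourfolds (granted KMM92); fivefolds with `CH₀` small: all of `GHC` iff `GHC(X, 5, 2)`; five- and sixfolds with `CH₀, CH₁` of rank `≤ 1`: all of `GHC`;
  sevenfolds: iff `GHC(X, 7, 3)`; seven- and eightfolds with `CH₀, CH₁, CH₂` of rank `≤ 1`: all of `GHC`.
* §5 Granted the typed ELV fact (`hR`): ALL of `GHC` for every smooth cubic hypersurface of dimension `≤ 6` and every smooth complete intersection of two quadrics of dimension `≤ 6`; cubic sevenfolds iff
  `GHC(X, 7, 3)`; granted ELV + Hirschowitz–Iyer (`h`): ALL of `GHC` for every smooth cubic eightfold.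

THE PRINTS.  A. Grothendieck (1969) [GrothendieckTopology1969] §1, pp. 300–301 (the amended statement); R. Laterveer (1998) [Laterveer1998] main theorem; Ch. Vial (2013) [Vial2013] Thm. 7.1 and proof p. 19,
§7.2.2–7.2.3; C. Voisin (2003) [VoisinHodgeII2003] §10.3.1 Thm. 10.29, Thm. 10.31, §10.2.2 Thm. 10.17, Cor. 10.18, Prop. 10.26; S. Bloch, V. Srinivas (1983) [BlochSrinivas1983] Thm. 1; C. Voisin (2025)
[Voisin2025] §4.2 Conj. 4.6, §4.3, §5.2 Cor. 5.7; C. Voisin (2002) [VoisinHodgeI2002] §6.2.3 Thm. 6.25, §11.3.1 Thm. 11.30; H. Esnault, M. Levine, E. Viehweg (1997) [EsnaultLevineViehweg1997] Thm. 4.6;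
A. Hirschowitz, J. Iyer (2010) [HirschowitzIyer2010] Thm. 1.5; J. Kollár, Y. Miyaoka, S. Mori (1992) [KollarMiyaokaMori1992] Thm. 3.3; J. Murre (1994) [MurreTorino1994] §5.7–5.8.

THE OBJECTS (all the tree's).  `GeneralHodgePropertyFor`, `HodgeConjectureFor`, `supportedClasses`, `Motives.ChowRankLEOneUpTo`, `Barriers.HodgeConjecture.HasChowZeroSupportedInDimLE`,
`IsRationallyChainConnected`, `IsFano`, `Motives.IsSmoothCompleteIntersection`, the named facts `Motives.EsnaultLevineViehweg1997_chowGroup_rank_le_one`, `Motives.HirschowitzIyer2010_chowTwo_rank_le_one_cubicEightfold`,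
`KollarMiyaokaMori1992_fano_rationallyChainConnected` (hypotheses only); the tree's `supportedClasses_eq_top_of_chowRankLEOneUpTo`, `generalHodgePropertyFor_of_supportedClasses_eq_top`,
`generalHodgePropertyFor_of_not_window`, `forall_generalHodgePropertyFor_iff_lower_window`, `generalHodgePropertyFor_two_mul_self_of_hodgeConjectureFor`, `forall_generalHodgePropertyFor_dim_four_iff_of_hasChowZeroSupportedInDimLE_two`,
`forall_generalHodgePropertyFor_dim_five_iff`, `generalHodgePropertyFor_one_of_hasChowZeroSupportedInDimLE_of_lt`, `hodgeConjectureFor_four_of_hasChowZeroSupportedInDimLE`, `forall_generalHodgePropertyFor_dim_three_of_chowRankLEOneUpTo_zero`,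
`generalHodgePropertyFor_of_dim_le_two`, and the seat's `hodgeConjectureFor_of_chowRankLEOneUpTo`, `chowRankLEOneUpTo_of_isSmoothCompleteIntersection_of_ELV`, `chowRankLEOneUpTo_one_of_cubic_of_ELV`.

DEVIATIONS / SCOPE.  Complex orientations (through the tree's supported-classes lemmas).  `GHC(X, k, r)` is the tree's `GeneralHodgePropertyFor n X k r` (Grothendieck's amended form: the largest rational
sub-Hodge structure of `Hᵏ` inside `Fʳ` is supported in codimension `r`).  §5 is conditional on the typed ELV / Hirschowitz–Iyer facts exactly as g33-#8; the Fano corollary on the typed KMM92 fact.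
Nothing is claimed about the middle odd cell in dimension `2k₀ + 5` (e.g. `GHC(X, 7, 3)` for cubic sevenfolds).

## References
* [GrothendieckTopology1969] A. Grothendieck, *Hodge's general conjecture is false for trivial reasons*, Topology 8 (1969) — §1, pp. 300–301.
* [Laterveer1998] R. Laterveer, *Algebraic varieties with small Chow groups*, J. Math. Kyoto Univ. 38 (1998) — main theorem.
* [Vial2013] Ch. Vial, *Algebraic cycles and fibrations*, Doc. Math. 18 (2013) — Thm. 7.1 and proof p. 19; §7.2.2; §7.2.3.
* [VoisinHodgeII2003] C. Voisin, *Hodge Theory and Complex Algebraic Geometry II* — Thm. 10.29, Thm. 10.31, Thm. 10.17, Cor. 10.18, Prop. 10.26.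
* [BlochSrinivas1983] S. Bloch, V. Srinivas, Amer. J. Math. 105 (1983) — Thm. 1.
* [Voisin2025] C. Voisin (2025) — §4.2 Conj. 4.6, §4.3, §5.2 Cor. 5.7.
* [VoisinHodgeI2002] C. Voisin, *Hodge Theory and Complex Algebraic Geometry I* — §6.2.3 Thm. 6.25, §11.3.1 Thm. 11.30.
* [EsnaultLevineViehweg1997] H. Esnault, M. Levine, E. Viehweg, Duke Math. J. 87 (1997) — Thm. 4.6.
* [HirschowitzIyer2010] A. Hirschowitz, J. N. N. Iyer, Contemp. Math. 522 (2010) — Thm. 1.5.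
* [KollarMiyaokaMori1992] J. Kollár, Y. Miyaoka, S. Mori, J. Differential Geom. 36 (1992) — Thm. 3.3.
* [MurreTorino1994] J. Murre, *Algebraic cycles and algebraic aspects of cohomology and K-theory* (Torino 1993), LNM 1594 — §5.7–5.8.

## Provenance
Lane `lit-hodgefound` (summit `HodgeConjecture`, Track 2 foundations), seat `lit-hodgefound-p29` (literature-prover, generation 33, row g33-#9).
-/

noncomputable section

open CategoryTheory AlgebraicGeometry Module Finset
open Literature.AlgebraicTopology.SingularHomology
open Literature.Geometry.Kaehler

namespace Literature.AlgebraicGeometry.HodgeTheory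

open Literature.AlgebraicGeometry.Motives
open Literature.Barriers.HodgeConjecture (HasChowZeroSupportedInDimLE)

variable {n m : ℕ} {X : SchemeOver ℂ}

/-! ### §1 `GHC(X, k, r)` for `r ≤ k₀ + 1` from `CH₀, …, CH_{k₀}` of rank `≤ 1` -/

/-- **`Nʳ Hᵏ(X) = Hᵏ(X)` for `r ≤ k₀ + 1` and `2r ≤ k + 1` when `CH₀(X)_ℚ, …, CH_{k₀}(X)_ℚ` have rank `≤ 1`** (the generalised decomposition of the diagonal at level `r − 1 ≤ k₀`, `2(r − 1) + 1 ≤ k`;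
`r = 0`: `N⁰ = everything`). [cite: VoisinHodgeII2003, Thm. 10.29 and proof of Thm. 10.31] [cite: Laterveer1998, main theorem (as quoted in Vial2013 Thm. 7.1)] [cite: GrothendieckTopology1969, §1] -/
theorem supportedClasses_eq_top_of_chowRankLEOneUpTo_of_le (hX : IsSmoothProjective n X) {k₀ : ℕ} (hCH : ChowRankLEOneUpTo X k₀) {k r : ℕ} (hr : r ≤ k₀ + 1)
    (hk : 2 * r ≤ k + 1) : supportedClasses X k r = ⊤ := by
  rcases Nat.eq_zero_or_pos r with rfl | hr0
  · exact supportedClasses_zero X k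
  · obtain ⟨s, rfl⟩ : ∃ s, r = s + 1 := ⟨r - 1, by omega⟩
    exact supportedClasses_eq_top_of_chowRankLEOneUpTo hX (hCH.mono (by omega)) (by omega)

/-- **Grothendieck's amended `GHC(X, k, r)` holds for EVERY degree `k` and every coniveau `r ≤ k₀ + 1` when `CH₀(X)_ℚ, …, CH_{k₀}(X)_ℚ` have rank `≤ 1`**: for `2r ≤ k + 1` because `Nʳ Hᵏ` is everything
(§1), for `2r > k + 1` because `Fʳ Hᵏ` contains no non-zero sub-Hodge structure.  (`k₀ = 0`, `r = 1`: the tree's `generalHodgePropertyFor_one_of_chowRankLEOneUpTo_zero`.)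
[cite: GrothendieckTopology1969, §1, pp. 300–301] [cite: VoisinHodgeII2003, Thm. 10.29 and proof of Thm. 10.31] [cite: Laterveer1998, main theorem (as quoted in Vial2013 Thm. 7.1)] [cite: Voisin2025, §4.2 Conj. 4.6 and §5.2 Cor. 5.7] -/
theorem generalHodgePropertyFor_of_chowRankLEOneUpTo (hX : IsSmoothProjective n X) {k₀ : ℕ} (hCH : ChowRankLEOneUpTo X k₀) {k r : ℕ} (hr : r ≤ k₀ + 1) :
    GeneralHodgePropertyFor n X k r := by
  rcases Nat.lt_or_ge (k + 1) (2 * r) with hk | hk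
  · exact generalHodgePropertyFor_of_not_window hX (Or.inr (Or.inl (by omega)))
  · exact generalHodgePropertyFor_of_supportedClasses_eq_top hX (supportedClasses_eq_top_of_chowRankLEOneUpTo_of_le hX hCH hr hk)

/-! ### §2 All of `GHC(X)` for `dim X ≤ 2k₀ + 4` -/

/-- **ALL of Grothendieck's amended general Hodge conjecture for `X` with `CH₀(X)_ℚ, …, CH_{k₀}(X)_ℚ` of rank `≤ 1` and `dim X ≤ 2k₀ + 4`**: `GHC(X, i, r)` for every `(i, r)`.  Reduction to the lower
window `1 ≤ r`, `2r ≤ i ≤ dim X` (hard Lefschetz); `r ≤ k₀ + 1` is §1; `r ≥ k₀ + 2` forces `i = 2r = 2k₀ + 4 = dim X`, the Hodge conjecture in degree `dim X`, which holds (g33-#7 `hodgeConjectureFor_of_chowRankLEOneUpTo`).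
[cite: GrothendieckTopology1969, §1, pp. 300–301] [cite: Vial2013, Thm 7.1 (first item), proof p. 19] [cite: VoisinHodgeII2003, Thm. 10.29 and proof of Thm. 10.31] [cite: VoisinHodgeI2002, §6.2.3 Thm. 6.25]
[cite: Voisin2025, §4.3 (first paragraph)] -/
theorem forall_generalHodgePropertyFor_of_chowRankLEOneUpTo (hX : IsSmoothProjective n X) {k₀ : ℕ} (hCH : ChowRankLEOneUpTo X k₀) (hn : n ≤ 2 * k₀ + 4) (i r : ℕ) :
    GeneralHodgePropertyFor n X i r := by
  refine (forall_generalHodgePropertyFor_iff_lower_window hX).2 (fun i r _ h2 hi _ ↦ ?_) i r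
  rcases Nat.lt_or_ge (k₀ + 1) r with hrk | hrk
  · obtain rfl : i = 2 * r := by omega
    exact generalHodgePropertyFor_two_mul_self_of_hodgeConjectureFor hX (hodgeConjectureFor_of_chowRankLEOneUpTo hX hCH (by omega)) r
  · exact generalHodgePropertyFor_of_chowRankLEOneUpTo hX hCH hrk

/-! ### §3 `dim X = 2k₀ + 5`: everything but the middle odd cell -/

/-- **For `dim X = 2k₀ + 5` and `CH₀, …, CH_{k₀}` of rank `≤ 1`, ALL of `GHC(X)` is EQUIVALENT to the single middle cell `GHC(X, dim X, k₀ + 2)`** (the level-one part of the middle cohomology is supported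
in codimension `k₀ + 2`): in the lower window `r ≥ k₀ + 2` leaves `(2k₀ + 4, k₀ + 2)` — `HC` in degree `2k₀ + 4`, which holds — and `(2k₀ + 5, k₀ + 2)`. [cite: GrothendieckTopology1969, §1, pp. 300–301]
[cite: Vial2013, Thm 7.1 (first item), proof p. 19] [cite: VoisinHodgeII2003, Thm. 10.29 and proof of Thm. 10.31] [cite: VoisinHodgeI2002, §6.2.3 Thm. 6.25] [cite: Voisin2025, §4.3 (first paragraph)] -/
theorem forall_generalHodgePropertyFor_iff_middle_of_chowRankLEOneUpTo (hX : IsSmoothProjective n X) {k₀ : ℕ} (hCH : ChowRankLEOneUpTo X k₀) (hn : n = 2 * k₀ + 5) :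
    (∀ i r : ℕ, GeneralHodgePropertyFor n X i r) ↔ GeneralHodgePropertyFor n X n (k₀ + 2) := by
  refine ⟨fun h ↦ h n (k₀ + 2), fun h ↦ (forall_generalHodgePropertyFor_iff_lower_window hX).2 fun i r _ h2 hi _ ↦ ?_⟩
  rcases Nat.lt_or_ge (k₀ + 1) r with hrk | hrk
  · obtain rfl : r = k₀ + 2 := by omega
    rcases (show i = 2 * (k₀ + 2) ∨ i = n by omega) with rfl | rfl
    · exact generalHodgePropertyFor_two_mul_self_of_hodgeConjectureFor hX (hodgeConjectureFor_of_chowRankLEOneUpTo hX hCH (by omega)) (k₀ + 2)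
    · exact h
  · exact generalHodgePropertyFor_of_chowRankLEOneUpTo hX hCH hrk

/-! ### §4 Unconditional instances: fourfolds, fivefolds, sixfolds, sevenfolds, eightfolds -/

/-- **ALL of `GHC` for a smooth projective FOURFOLD with `CH₀(X)_ℚ` of rank `≤ 1`** (rationally connected, Fano, cubic / quartic / quintic fourfolds): the tree's «iff `GHC(X, 4, 2)`»
(`forall_generalHodgePropertyFor_dim_four_iff_of_chowRankLEOneUpTo_zero`) with `HC(X)` for such fourfolds. [cite: GrothendieckTopology1969, §1, pp. 300–301] [cite: BlochSrinivas1983, Thm. 1] [cite: Voisin2025, §5.2 Cor. 5.7, §4.3]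
[cite: VoisinHodgeII2003, Thm. 10.17 and Prop. 10.26] -/
theorem forall_generalHodgePropertyFor_dim_four_of_chowRankLEOneUpTo_zero (hX : IsSmoothProjective 4 X) (hCH : ChowRankLEOneUpTo X 0) (i r : ℕ) : GeneralHodgePropertyFor 4 X i r :=
  forall_generalHodgePropertyFor_of_chowRankLEOneUpTo hX hCH (by norm_num) i r

/-- **ALL of `GHC` for a smooth projective FOURFOLD whose `CH₀` is supported on a SURFACE**: the tree's «iff `GHC(X, 4, 2)`» (`forall_generalHodgePropertyFor_dim_four_iff_of_hasChowZeroSupportedInDimLE_two`)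
closed by the tree's `HC` for fourfolds with degenerate `CH₀` (`hodgeConjectureFor_four_of_hasChowZeroSupportedInDimLE`). [cite: GrothendieckTopology1969, §1, pp. 300–301] [cite: BlochSrinivas1983, Thm. 1]
[cite: VoisinHodgeII2003, Thm. 10.17, Cor. 10.21 and Prop. 10.26] [cite: Voisin2025, §5.2 Cor. 5.7, §4.3] -/
theorem forall_generalHodgePropertyFor_dim_four_of_hasChowZeroSupportedInDimLE_two (hX : IsSmoothProjective 4 X) (hW : HasChowZeroSupportedInDimLE X 2) (i r : ℕ) :
    GeneralHodgePropertyFor 4 X i r :=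
  (forall_generalHodgePropertyFor_dim_four_iff_of_hasChowZeroSupportedInDimLE_two hX hW).2
    (generalHodgePropertyFor_two_mul_self_of_hodgeConjectureFor hX (hodgeConjectureFor_four_of_hasChowZeroSupportedInDimLE hX (by norm_num) hW) 2) i r

/-- **ALL of `GHC` for a RATIONALLY CHAIN CONNECTED smooth projective fourfold.** [cite: GrothendieckTopology1969, §1, pp. 300–301] [cite: BlochSrinivas1983, Thm. 1] [cite: VoisinHodgeII2003, Thm. 10.17, Cor. 10.18 and Prop. 10.26] -/
theorem forall_generalHodgePropertyFor_dim_four_of_isRationallyChainConnected (hX : IsSmoothProjective 4 X) (hRC : IsRationallyChainConnected X) (i r : ℕ) : GeneralHodgePropertyFor 4 X i r :=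
  forall_generalHodgePropertyFor_dim_four_of_hasChowZeroSupportedInDimLE_two hX ((hRC.hasChowZeroSupportedInDimLE_zero hX).mono (by norm_num)) i r

/-- **ALL of `GHC` for a FANO fourfold, granted the printed fact `KollarMiyaokaMori1992_fano_rationallyChainConnected`.** [cite: KollarMiyaokaMori1992, Thm. 3.3] [cite: GrothendieckTopology1969, §1, pp. 300–301] [cite: BlochSrinivas1983, Thm. 1] -/
theorem forall_generalHodgePropertyFor_dim_four_of_isFano (hKMM : KollarMiyaokaMori1992_fano_rationallyChainConnected) {F : SchemeOver ℂ} (hF : IsFano 4 F) (i r : ℕ) :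
    GeneralHodgePropertyFor 4 F i r :=
  forall_generalHodgePropertyFor_dim_four_of_hasChowZeroSupportedInDimLE_two hF.isSmoothProjective ((hKMM.hasChowZeroSupportedInDimLE_zero hF).mono (by norm_num)) i r

/-- **FIVEFOLDS with `CH₀(X)_ℚ` of rank `≤ 1`: ALL of `GHC(X)` ⟺ `GHC(X, 5, 2)`** (the level-one part of `H⁵` is supported in codimension `2`; every other cell holds). [cite: GrothendieckTopology1969, §1, pp. 300–301]
[cite: BlochSrinivas1983, Thm. 1] [cite: Voisin2025, §5.2 Cor. 5.7, §4.3] [cite: MurreTorino1994, §5.7–§5.8] -/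
theorem forall_generalHodgePropertyFor_dim_five_iff_of_chowRankLEOneUpTo_zero (hX : IsSmoothProjective 5 X) (hCH : ChowRankLEOneUpTo X 0) :
    (∀ i r : ℕ, GeneralHodgePropertyFor 5 X i r) ↔ GeneralHodgePropertyFor 5 X 5 2 :=
  forall_generalHodgePropertyFor_iff_middle_of_chowRankLEOneUpTo hX hCH (by norm_num)

/-- **FIVEFOLDS whose `CH₀` is supported on a SURFACE: ALL of `GHC(X)` ⟺ `GHC(X, 5, 2)`** (`(3,1)`, `(4,1)`, `(5,1)` by Bloch–Srinivas, the tree's fivefold window). [cite: GrothendieckTopology1969, §1, pp. 300–301]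
[cite: BlochSrinivas1983, Thm. 1] [cite: VoisinHodgeII2003, Thm. 10.17 and Cor. 10.21] [cite: Voisin2025, §5.2 Cor. 5.7, §4.3] -/
theorem forall_generalHodgePropertyFor_dim_five_iff_of_hasChowZeroSupportedInDimLE_two (hX : IsSmoothProjective 5 X) (hW : HasChowZeroSupportedInDimLE X 2) :
    (∀ i r : ℕ, GeneralHodgePropertyFor 5 X i r) ↔ GeneralHodgePropertyFor 5 X 5 2 := by
  rw [forall_generalHodgePropertyFor_dim_five_iff hX]
  exact ⟨fun h ↦ h.2.2.2, fun h ↦ ⟨generalHodgePropertyFor_one_of_hasChowZeroSupportedInDimLE_of_lt hX hW (by norm_num),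
    generalHodgePropertyFor_one_of_hasChowZeroSupportedInDimLE_of_lt hX hW (by norm_num), generalHodgePropertyFor_one_of_hasChowZeroSupportedInDimLE_of_lt hX hW (by norm_num), h⟩⟩

/-- **ALL of `GHC` for a smooth projective FIVEFOLD with `CH₀, CH₁` of rank `≤ 1`** (`5 ≤ 2·1 + 4`; e.g. smooth cubic fivefolds, §5). [cite: GrothendieckTopology1969, §1, pp. 300–301] [cite: VoisinHodgeII2003, Thm. 10.29 and proof of Thm. 10.31]
[cite: Vial2013, Thm 7.1 (first item)] -/
theorem forall_generalHodgePropertyFor_dim_five_of_chowRankLEOneUpTo_one (hX : IsSmoothProjective 5 X) (hCH : ChowRankLEOneUpTo X 1) (i r : ℕ) : GeneralHodgePropertyFor 5 X i r :=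
  forall_generalHodgePropertyFor_of_chowRankLEOneUpTo hX hCH (by norm_num) i r

/-- **ALL of `GHC` for a smooth projective SIXFOLD with `CH₀, CH₁` of rank `≤ 1`** (`6 = 2·1 + 4`; e.g. smooth cubic sixfolds, §5). [cite: GrothendieckTopology1969, §1, pp. 300–301] [cite: VoisinHodgeII2003, Thm. 10.29 and proof of Thm. 10.31]
[cite: Vial2013, Thm 7.1 (first item)] -/
theorem forall_generalHodgePropertyFor_dim_six_of_chowRankLEOneUpTo_one (hX : IsSmoothProjective 6 X) (hCH : ChowRankLEOneUpTo X 1) (i r : ℕ) : GeneralHodgePropertyFor 6 X i r :=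
  forall_generalHodgePropertyFor_of_chowRankLEOneUpTo hX hCH (by norm_num) i r

/-- **SEVENFOLDS with `CH₀, CH₁` of rank `≤ 1`: ALL of `GHC(X)` ⟺ `GHC(X, 7, 3)`.** [cite: GrothendieckTopology1969, §1, pp. 300–301] [cite: VoisinHodgeII2003, Thm. 10.29 and proof of Thm. 10.31] [cite: Vial2013, Thm 7.1 (first item)] -/
theorem forall_generalHodgePropertyFor_dim_seven_iff_of_chowRankLEOneUpTo_one (hX : IsSmoothProjective 7 X) (hCH : ChowRankLEOneUpTo X 1) :
    (∀ i r : ℕ, GeneralHodgePropertyFor 7 X i r) ↔ GeneralHodgePropertyFor 7 X 7 3 :=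
  forall_generalHodgePropertyFor_iff_middle_of_chowRankLEOneUpTo hX hCH (by norm_num)

/-- **ALL of `GHC` for a smooth projective SEVENFOLD with `CH₀, CH₁, CH₂` of rank `≤ 1`.** [cite: GrothendieckTopology1969, §1, pp. 300–301] [cite: VoisinHodgeII2003, Thm. 10.29 and proof of Thm. 10.31] [cite: Vial2013, Thm 7.1 (first item)] -/
theorem forall_generalHodgePropertyFor_dim_seven_of_chowRankLEOneUpTo_two (hX : IsSmoothProjective 7 X) (hCH : ChowRankLEOneUpTo X 2) (i r : ℕ) : GeneralHodgePropertyFor 7 X i r :=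
  forall_generalHodgePropertyFor_of_chowRankLEOneUpTo hX hCH (by norm_num) i r

/-- **ALL of `GHC` for a smooth projective EIGHTFOLD with `CH₀, CH₁, CH₂` of rank `≤ 1`** (`8 = 2·2 + 4`; e.g. smooth cubic eightfolds, §5). [cite: GrothendieckTopology1969, §1, pp. 300–301] [cite: VoisinHodgeII2003, Thm. 10.29 and proof of Thm. 10.31]
[cite: Vial2013, Thm 7.1 (first item) and §7.2.2] -/
theorem forall_generalHodgePropertyFor_dim_eight_of_chowRankLEOneUpTo_two (hX : IsSmoothProjective 8 X) (hCH : ChowRankLEOneUpTo X 2) (i r : ℕ) : GeneralHodgePropertyFor 8 X i r :=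
  forall_generalHodgePropertyFor_of_chowRankLEOneUpTo hX hCH (by norm_num) i r

/-! ### §5 Complete intersections of very small degree, granted ELV (+ Hirschowitz–Iyer) -/

/-- **ALL of `GHC` for every smooth cubic hypersurface of dimension `m ≤ 6` (a smooth complete intersection of multidegree `(3)` in `ℙ^{m+1}_ℂ`), granted Esnault–Levine–Viehweg** — in particular for all
smooth cubic fivefolds and SIXFOLDS.  `m ≤ 2`: the tree's `generalHodgePropertyFor_of_dim_le_two`; `m = 3`: `CH₀` (`3 ≤ 4`) and the tree's threefold theorem; `m = 4`: `CH₀`, §2 with `k₀ = 0`;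
`m = 5, 6`: `CH₀, CH₁` (`6 ≤ m + 1`), §2 with `k₀ = 1`. [cite: Vial2013, Thm 7.1 (first item) and §7.2.2] [cite: EsnaultLevineViehweg1997, Thm 4.6 (announced as Thm 4.5 in the Introduction), first bullet]
[cite: GrothendieckTopology1969, §1, pp. 300–301] [cite: VoisinHodgeII2003, Thm. 10.29 and proof of Thm. 10.31] [cite: MurreTorino1994, §5.8.1] -/
theorem forall_generalHodgePropertyFor_cubic_of_ELV (hR : EsnaultLevineViehweg1997_chowGroup_rank_le_one.{0}) (hX : IsSmoothCompleteIntersection m (fun _ : Fin 1 ↦ 3) X) (hm : m ≤ 6)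
    (i r : ℕ) : GeneralHodgePropertyFor m X i r := by
  rcases Nat.lt_or_ge m 3 with h2 | h3
  · exact generalHodgePropertyFor_of_dim_le_two (by omega) hX.1 i r
  have hCH0 : ChowRankLEOneUpTo X 0 :=
    chowRankLEOneUpTo_of_isSmoothCompleteIntersection_of_ELV hR hX (fun _ ↦ by norm_num) (Or.inl ⟨0, le_rfl⟩) (by simp; omega)
  rcases Nat.lt_or_ge m 4 with h3' | h4
  · obtain rfl : m = 3 := by omega
    exact forall_generalHodgePropertyFor_dim_three_of_chowRankLEOneUpTo_zero hX.1 hCH0 i r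
  rcases Nat.lt_or_ge m 5 with h4' | h5
  · exact forall_generalHodgePropertyFor_of_chowRankLEOneUpTo hX.1 hCH0 (by omega) i r
  · exact forall_generalHodgePropertyFor_of_chowRankLEOneUpTo hX.1 (chowRankLEOneUpTo_one_of_cubic_of_ELV hR hX h5) (by omega) i r

/-- **ALL of `GHC` for every smooth cubic SIXFOLD `X ⊂ ℙ⁷_ℂ`, granted ELV** (`N²H⁶ = H⁶`: `GHC(X, 6, r)` for `r ≤ 2`; `r = 3` is `HC(X)`, g33-#8; the other degrees are Lefschetz). [cite: Vial2013, Thm 7.1 (first item) and §7.2.2]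
[cite: EsnaultLevineViehweg1997, Thm 4.6 (announced as Thm 4.5 in the Introduction), first bullet] [cite: GrothendieckTopology1969, §1, pp. 300–301] [cite: VoisinHodgeII2003, Thm. 10.29 and proof of Thm. 10.31] -/
theorem forall_generalHodgePropertyFor_cubicSixfold_of_ELV (hR : EsnaultLevineViehweg1997_chowGroup_rank_le_one.{0}) (hX : IsSmoothCompleteIntersection 6 (fun _ : Fin 1 ↦ 3) X) (i r : ℕ) :
    GeneralHodgePropertyFor 6 X i r :=
  forall_generalHodgePropertyFor_cubic_of_ELV hR hX (by norm_num) i r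

/-- **Smooth cubic SEVENFOLDS, granted ELV: ALL of `GHC(X)` ⟺ `GHC(X, 7, 3)`** (the level-one part of `H⁷` supported in codimension `3`; `N²H⁷ = H⁷` holds). [cite: Vial2013, Thm 7.1 (first item) and §7.2.2]
[cite: EsnaultLevineViehweg1997, Thm 4.6 (announced as Thm 4.5 in the Introduction), first bullet] [cite: GrothendieckTopology1969, §1, pp. 300–301] -/
theorem forall_generalHodgePropertyFor_cubicSevenfold_iff_of_ELV (hR : EsnaultLevineViehweg1997_chowGroup_rank_le_one.{0}) (hX : IsSmoothCompleteIntersection 7 (fun _ : Fin 1 ↦ 3) X) :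
    (∀ i r : ℕ, GeneralHodgePropertyFor 7 X i r) ↔ GeneralHodgePropertyFor 7 X 7 3 :=
  forall_generalHodgePropertyFor_dim_seven_iff_of_chowRankLEOneUpTo_one hX.1 (chowRankLEOneUpTo_one_of_cubic_of_ELV hR hX (by norm_num))

/-- **ALL of `GHC` for every smooth cubic EIGHTFOLD `X ⊂ ℙ⁹_ℂ` (multidegree `![3]`), granted the two typed Chow facts** (`CH₀, CH₁` by ELV, `CH₂` by Hirschowitz–Iyer / Otwinowska; `8 = 2·2 + 4`): in particular
`N³H⁸(X) = H⁸(X)` and `HC(X)`. [cite: Vial2013, Thm 7.1 (first item) and §7.2.2] [cite: HirschowitzIyer2010, Thm. 1.5 at (9,2,1,(3)); §1.7] [cite: EsnaultLevineViehweg1997, Thm 4.6 (announced as Thm 4.5 in the Introduction), first bullet]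
[cite: GrothendieckTopology1969, §1, pp. 300–301] -/
theorem forall_generalHodgePropertyFor_cubicEightfoldCI_of_hirschowitzIyer_of_ELV (h : HirschowitzIyer2010_chowTwo_rank_le_one_cubicEightfold.{0})
    (hR : EsnaultLevineViehweg1997_chowGroup_rank_le_one.{0}) (hX : IsSmoothCompleteIntersection 8 ![3] X) (i r : ℕ) : GeneralHodgePropertyFor 8 X i r :=
  forall_generalHodgePropertyFor_dim_eight_of_chowRankLEOneUpTo_two hX.1
    ((chowRankLEOneUpTo_iff_chowGroup X 2).2 fun _ hj a b ↦ chowGroup_rank_le_one_of_le_two_cubicEightfold h hR hX hj a b) i r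

/-- **ALL of `GHC` for every smooth complete intersection of TWO QUADRICS of dimension `m ≤ 6`, granted ELV** (`m ≤ 2` free; `m = 3`: `CH₀` (`4 ≤ 5`); `4 ≤ m ≤ 6`: `CH₀, CH₁` (`l = 1 ≤ c − 1`, `6 ≤ m + 2`)).
[cite: Vial2013, Thm 7.1 (first item) and §7.2.3] [cite: EsnaultLevineViehweg1997, Thm 4.6 (announced as Thm 4.5 in the Introduction)] [cite: GrothendieckTopology1969, §1, pp. 300–301] [cite: VoisinHodgeII2003, Thm. 10.29 and proof of Thm. 10.31] -/
theorem forall_generalHodgePropertyFor_twoQuadrics_of_ELV (hR : EsnaultLevineViehweg1997_chowGroup_rank_le_one.{0}) (hX : IsSmoothCompleteIntersection m (fun _ : Fin 2 ↦ 2) X) (hm : m ≤ 6)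
    (i r : ℕ) : GeneralHodgePropertyFor m X i r := by
  rcases Nat.lt_or_ge m 3 with h2 | h3
  · exact generalHodgePropertyFor_of_dim_le_two (by omega) hX.1 i r
  rcases Nat.lt_or_ge m 4 with h3' | h4
  · obtain rfl : m = 3 := by omega
    exact forall_generalHodgePropertyFor_dim_three_of_chowRankLEOneUpTo_zero hX.1
      (chowRankLEOneUpTo_of_isSmoothCompleteIntersection_of_ELV hR hX (fun _ ↦ le_rfl) (l := 0) (Or.inr (by norm_num)) (by simp)) i r
  · exact forall_generalHodgePropertyFor_of_chowRankLEOneUpTo hX.1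
      (chowRankLEOneUpTo_of_isSmoothCompleteIntersection_of_ELV hR hX (fun _ ↦ le_rfl) (l := 1) (Or.inr le_rfl) (by simp [Nat.choose]; omega)) (by omega) i r

end Literature.AlgebraicGeometry.HodgeTheory

end
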